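import Mathlib
import Literature.NumberTheory.LFunctions.Zhang2022.Section8ShiftPerturbation
import Literature.NumberTheory.LFunctions.Zhang2022.Section8dStatements
import HarnessLib

/-!
# Zhang (2022) §8 pp. 48–49: `𝔣_{jμ}(Pᶻ) = 𝔣𝔣_{jμ}(z) + O(𝓛⁻⁸)`, `𝔤_{jμ}(Pᶻ) = 𝔤𝔥_{jμ}(z) + O(𝓛⁻⁸)`
# — DAG nodes `Z22:§8.u049` (μ = 6) and `Z22:§8.u050` (μ = 7), DISCHARGED (part 2 of 2)

Topic `Literature/NumberTheory/LFunctions/Zhang2022` (Landau–Siegel audit tree; verdict-neutral).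
Y. Zhang, *Discrete mean estimates and the Landau–Siegel zero*, arXiv:2211.02515v1 (2022)
[Zhang2022LandauSiegel] — **an unrefereed manuscript under adjudication** (D-0069 width campaign,
layer L2, discharge seat sz-d19). This file PROVES the printed step "By direct calculation, for
`0 ≤ z ≤ 1` we have `𝔣_{j6}(Pᶻ) = 𝔣𝔣_{j6}(z) + O(𝓛⁻⁸)`, `𝔤_{j6}(Pᶻ) = 𝔤𝔥_{j6}(z) + O(𝓛⁻⁸)`,
`𝔣_{j7}(Pᶻ) = 𝔣𝔣_{j7}(z) + O(𝓛⁻⁸)`, `𝔤_{j7}(Pᶻ) = 𝔤𝔥_{j7}(z) + O(𝓛⁻⁸)`" [Z22 p.48 last line –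
p.49, tex L2480–L2504] for the skeleton's TRUE shifts `β_j = β_j(c′)` of (2.13) (`Skeleton.frakfW`,
`Skeleton.frakgW`, `Skeleton.bigP`) against the printed closed forms (8.13)–(8.18) (banked
`ff16 … gh37`, `Section8Defs`), with EXPLICIT constants `5|c′|π²` (the six `𝔣`'s) and
`70|c′|π² + 40c′²π³` (the six `𝔤`'s), for every `D ≥ 3` and `0 ≤ z ≤ 1` (`frakfW_six/seven`,
`frakgW_six/seven`): main order exact by the tree's `frakf_main_*`, `frakg_main_*`
(`Section8MainTerms`), perturbation by `Section8ShiftPerturbation` (part 1).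
`step8u049_holds` / `step8u050_holds` then PROVE the typed claims `Section8dStatements.Step8u049 c′` /
`Step8u050 c′` (slice L2-t9, p411983) as stated — `∃ C, ForAllLarge …, ∀ j ∈ {1,2,3}, ∀ z ∈ [0,1], …`
with `C = 75|c′|π² + 40c′²π³` and threshold `D ≥ 3` — by the case split `j = 1, 2, 3` and the
dispatcher lemmas `ffP_one_six`, … of that file.
WHAT THIS FILE IS NOT: anything about (8.11)–(8.12), the `o(α)` of the substitution displays,
(8.23)–(8.24), or Theorems 1–2 / Landau–Siegel zeros. No definitions, no new facts.

## References

* Y. Zhang, arXiv:2211.02515v1 (2022), §8 pp. 48–49 (tex L2480–L2504), (8.13)–(8.18); §2 (2.6),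
  (2.10), (2.13), (2.22). [cite: Zhang2022LandauSiegel, §8 pp.48–49]
-/

noncomputable section

open Complex Real

namespace Literature.NumberTheory.LFunctions.Zhang2022.Section8ProfilesAtPz

open Skeleton Section8ShiftPerturbation

/-! ## The twelve printed identities with their `O(𝓛⁻⁸)` (μ = 6: `Z22:§8.u049`; μ = 7: `Z22:§8.u050`) -/

section Twelve

variable (c' : ℝ) {D : ℕ}

/-- (8.13)–(8.15), `𝔣`-parts: `‖𝔣_{j6}(Pᶻ) − 𝔣𝔣_{j6}(z)‖ ≤ 5|c′|π²𝓛⁻⁸` for `j = 1, 2, 3`, `D ≥ 3`,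
`0 ≤ z ≤ 1` (main order exact: `frakf_main_16/26/36`). [cite: Zhang2022LandauSiegel, §8 p.48, (8.13)–(8.15)] -/
theorem frakfW_six (hD : 3 ≤ D) {z : ℝ} (hz0 : 0 ≤ z) (hz1 : z ≤ 1) :
    ‖frakfW c' D 1 6 (bigP D ^ z) - ff16 z‖ ≤ 5 * |c'| * π ^ 2 * (ell D ^ 8)⁻¹ ∧
      ‖frakfW c' D 2 6 (bigP D ^ z) - ff26 z‖ ≤ 5 * |c'| * π ^ 2 * (ell D ^ 8)⁻¹ ∧
        ‖frakfW c' D 3 6 (bigP D ^ z) - ff36 z‖ ≤ 5 * |c'| * π ^ 2 * (ell D ^ 8)⁻¹ := by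
  obtain ⟨e1, e2, e3⟩ := frakfW_one_two_three c' D 6 (bigP D ^ z)
  have h := alpha_mul_ell_pow_nine hD
  refine ⟨?_, ?_, ?_⟩
  · rw [e1, ofReal_log_bigP_rpow, betaMu_six, ← frakf_main_16 h z]
    exact frakf_rpow_estimate c' hD (norm_beta1_sub_main_le c' hD) _ hz0 hz1
  · rw [e2, ofReal_log_bigP_rpow, betaMu_six, ← frakf_main_26 h z]
    exact frakf_rpow_estimate c' hD (norm_beta2_sub_main_le c' hD) _ hz0 hz1
  · rw [e3, ofReal_log_bigP_rpow, betaMu_six, ← frakf_main_36 h z]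
    exact frakf_rpow_estimate c' hD (norm_beta3_sub_main_le c' hD) _ hz0 hz1

/-- (8.16)–(8.18), `𝔣`-parts: `‖𝔣_{j7}(Pᶻ) − 𝔣𝔣_{j7}(z)‖ ≤ 5|c′|π²𝓛⁻⁸` for `j = 1, 2, 3`
(main order: `frakf_main_17/27/37`). [cite: Zhang2022LandauSiegel, §8 p.49, (8.16)–(8.18)] -/
theorem frakfW_seven (hD : 3 ≤ D) {z : ℝ} (hz0 : 0 ≤ z) (hz1 : z ≤ 1) :
    ‖frakfW c' D 1 7 (bigP D ^ z) - ff17 z‖ ≤ 5 * |c'| * π ^ 2 * (ell D ^ 8)⁻¹ ∧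
      ‖frakfW c' D 2 7 (bigP D ^ z) - ff27 z‖ ≤ 5 * |c'| * π ^ 2 * (ell D ^ 8)⁻¹ ∧
        ‖frakfW c' D 3 7 (bigP D ^ z) - ff37 z‖ ≤ 5 * |c'| * π ^ 2 * (ell D ^ 8)⁻¹ := by
  obtain ⟨e1, e2, e3⟩ := frakfW_one_two_three c' D 7 (bigP D ^ z)
  have h := alpha_mul_ell_pow_nine hD
  refine ⟨?_, ?_, ?_⟩
  · rw [e1, ofReal_log_bigP_rpow, betaMu_seven, ← frakf_main_17 h z]
    exact frakf_rpow_estimate c' hD (norm_beta1_sub_main_le c' hD) _ hz0 hz1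
  · rw [e2, ofReal_log_bigP_rpow, betaMu_seven, ← frakf_main_27 h z]
    exact frakf_rpow_estimate c' hD (norm_beta2_sub_main_le c' hD) _ hz0 hz1
  · rw [e3, ofReal_log_bigP_rpow, betaMu_seven, ← frakf_main_37 h z]
    exact frakf_rpow_estimate c' hD (norm_beta3_sub_main_le c' hD) _ hz0 hz1

/-- (8.13)–(8.15), `𝔤`-parts: `‖𝔤_{j6}(Pᶻ) − 𝔤𝔥_{j6}(z)‖ ≤ (70|c′|π² + 40c′²π³)𝓛⁻⁸` for `j = 1, 2, 3`
(main order: `frakg_main_16/26/36`). [cite: Zhang2022LandauSiegel, §8 p.48, (8.13)–(8.15)] -/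
theorem frakgW_six (hD : 3 ≤ D) {z : ℝ} (hz0 : 0 ≤ z) (hz1 : z ≤ 1) :
    ‖frakgW c' D 1 6 (bigP D ^ z) - gh16 z‖ ≤ (70 * |c'| * π ^ 2 + 40 * |c'| ^ 2 * π ^ 3) * (ell D ^ 8)⁻¹ ∧
      ‖frakgW c' D 2 6 (bigP D ^ z) - gh26 z‖ ≤
          (70 * |c'| * π ^ 2 + 40 * |c'| ^ 2 * π ^ 3) * (ell D ^ 8)⁻¹ ∧
        ‖frakgW c' D 3 6 (bigP D ^ z) - gh36 z‖ ≤
          (70 * |c'| * π ^ 2 + 40 * |c'| ^ 2 * π ^ 3) * (ell D ^ 8)⁻¹ := by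
  obtain ⟨e1, e2, e3⟩ := frakgW_one_two_three c' D 6 (bigP D ^ z)
  have h := alpha_mul_ell_pow_nine hD
  have hα := (alpha_pos' hD).ne'
  have b1 := norm_beta1_sub_main_le c' hD
  have b2 := norm_beta2_sub_main_le c' hD
  have b3 := norm_beta3_sub_main_le c' hD
  refine ⟨?_, ?_, ?_⟩
  · rw [e1, ofReal_log_bigP_rpow, betaMu_six, ← frakg_main_16 hα h z]
    exact frakg_rpow_estimate c' hD (by norm_num) (by norm_num) (by norm_num) (by norm_num) b2 b3
      (by norm_num) (by norm_num) hz0 hz1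
  · rw [e2, ofReal_log_bigP_rpow, betaMu_six, ← frakg_main_26 hα h z]
    exact frakg_rpow_estimate c' hD (by norm_num) (by norm_num) (by norm_num) (by norm_num) b3 b1
      (by norm_num) (by norm_num) hz0 hz1
  · rw [e3, ofReal_log_bigP_rpow, betaMu_six, ← frakg_main_36 hα h z]
    exact frakg_rpow_estimate c' hD (by norm_num) (by norm_num) (by norm_num) (by norm_num) b1 b2
      (by norm_num) (by norm_num) hz0 hz1

/-- (8.16)–(8.18), `𝔤`-parts: `‖𝔤_{j7}(Pᶻ) − 𝔤𝔥_{j7}(z)‖ ≤ (70|c′|π² + 40c′²π³)𝓛⁻⁸` for `j = 1, 2, 3`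
(main order: `frakg_main_17/27/37`). [cite: Zhang2022LandauSiegel, §8 p.49, (8.16)–(8.18)] -/
theorem frakgW_seven (hD : 3 ≤ D) {z : ℝ} (hz0 : 0 ≤ z) (hz1 : z ≤ 1) :
    ‖frakgW c' D 1 7 (bigP D ^ z) - gh17 z‖ ≤ (70 * |c'| * π ^ 2 + 40 * |c'| ^ 2 * π ^ 3) * (ell D ^ 8)⁻¹ ∧
      ‖frakgW c' D 2 7 (bigP D ^ z) - gh27 z‖ ≤
          (70 * |c'| * π ^ 2 + 40 * |c'| ^ 2 * π ^ 3) * (ell D ^ 8)⁻¹ ∧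
        ‖frakgW c' D 3 7 (bigP D ^ z) - gh37 z‖ ≤
          (70 * |c'| * π ^ 2 + 40 * |c'| ^ 2 * π ^ 3) * (ell D ^ 8)⁻¹ := by
  obtain ⟨e1, e2, e3⟩ := frakgW_one_two_three c' D 7 (bigP D ^ z)
  have h := alpha_mul_ell_pow_nine hD
  have hα := (alpha_pos' hD).ne'
  have b1 := norm_beta1_sub_main_le c' hD
  have b2 := norm_beta2_sub_main_le c' hD
  have b3 := norm_beta3_sub_main_le c' hD
  refine ⟨?_, ?_, ?_⟩
  · rw [e1, ofReal_log_bigP_rpow, betaMu_seven, ← frakg_main_17 hα h z]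
    exact frakg_rpow_estimate c' hD (by norm_num) (by norm_num) (by norm_num) (by norm_num) b2 b3
      (by norm_num) (by norm_num) hz0 hz1
  · rw [e2, ofReal_log_bigP_rpow, betaMu_seven, ← frakg_main_27 hα h z]
    exact frakg_rpow_estimate c' hD (by norm_num) (by norm_num) (by norm_num) (by norm_num) b3 b1
      (by norm_num) (by norm_num) hz0 hz1
  · rw [e3, ofReal_log_bigP_rpow, betaMu_seven, ← frakg_main_37 hα h z]
    exact frakg_rpow_estimate c' hD (by norm_num) (by norm_num) (by norm_num) (by norm_num) b1 b2
      (by norm_num) (by norm_num) hz0 hz1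

end Twelve

/-! ## The two typed claims `Section8dStatements.Step8u049 c′`, `Step8u050 c′`, PROVED -/

section Typed

open Section8dStatements

variable (c' : ℝ) {D : ℕ}

/-- `5|c′|π²·t ≤ (75|c′|π² + 40c′²π³)·t` and `(70|c′|π² + 40c′²π³)·t ≤ (75|c′|π² + 40c′²π³)·t` for
`t = 𝓛⁻⁸ ≥ 0` (merging the two explicit constants). [cite: Zhang2022LandauSiegel, §8 p.48] -/
theorem constants_le (hD : 3 ≤ D) :
    5 * |c'| * π ^ 2 * (ell D ^ 8)⁻¹ ≤ (75 * |c'| * π ^ 2 + 40 * |c'| ^ 2 * π ^ 3) * (ell D ^ 8)⁻¹ ∧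
      (70 * |c'| * π ^ 2 + 40 * |c'| ^ 2 * π ^ 3) * (ell D ^ 8)⁻¹ ≤
        (75 * |c'| * π ^ 2 + 40 * |c'| ^ 2 * π ^ 3) * (ell D ^ 8)⁻¹ := by
  have ht : 0 ≤ (ell D ^ 8)⁻¹ := by
    have := (one_lt_ell' hD).le; positivity
  constructor
  · gcongr; nlinarith [abs_nonneg c', Real.pi_pos, sq_nonneg (|c'| * π)]
  · gcongr; nlinarith [abs_nonneg c', Real.pi_pos]

/-- **`Z22:§8.u049`, explicit form**: for `D ≥ 3`, `j ∈ {1,2,3}`, `0 ≤ z ≤ 1`,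
`‖𝔣_{j6}(Pᶻ) − 𝔣𝔣_{j6}(z)‖ ≤ K𝓛⁻⁸` and `‖𝔤_{j6}(Pᶻ) − 𝔤𝔥_{j6}(z)‖ ≤ K𝓛⁻⁸`, `K = 75|c′|π² + 40c′²π³`,
with the dispatchers `ffP j 6`, `ghP j 6` of `Section8dStatements`. [cite: Zhang2022LandauSiegel, §8 p.48, tex L2480] -/
theorem profiles_six (hD : 3 ≤ D) {j : ℕ} (hj : j ∈ ({1, 2, 3} : Finset ℕ)) {z : ℝ} (hz0 : 0 ≤ z)
    (hz1 : z ≤ 1) :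
    ‖frakfW c' D j 6 (bigP D ^ z) - ffP j 6 z‖ ≤
        (75 * |c'| * π ^ 2 + 40 * |c'| ^ 2 * π ^ 3) * (ell D ^ 8)⁻¹ ∧
      ‖frakgW c' D j 6 (bigP D ^ z) - ghP j 6 z‖ ≤
        (75 * |c'| * π ^ 2 + 40 * |c'| ^ 2 * π ^ 3) * (ell D ^ 8)⁻¹ := by
  obtain ⟨hf, hg⟩ := constants_le c' hD
  obtain ⟨f1, f2, f3⟩ := frakfW_six c' hD hz0 hz1
  obtain ⟨g1, g2, g3⟩ := frakgW_six c' hD hz0 hz1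
  simp only [Finset.mem_insert, Finset.mem_singleton] at hj
  rcases hj with rfl | rfl | rfl
  · rw [ffP_one_six, ghP_one_six]; exact ⟨f1.trans hf, g1.trans hg⟩
  · rw [ffP_two_six, ghP_two_six]; exact ⟨f2.trans hf, g2.trans hg⟩
  · rw [ffP_three_six, ghP_three_six]; exact ⟨f3.trans hf, g3.trans hg⟩

/-- **`Z22:§8.u050`, explicit form**: the same for `μ = 7` (`ffP j 7`, `ghP j 7`).
[cite: Zhang2022LandauSiegel, §8 p.49, tex L2483] -/
theorem profiles_seven (hD : 3 ≤ D) {j : ℕ} (hj : j ∈ ({1, 2, 3} : Finset ℕ)) {z : ℝ} (hz0 : 0 ≤ z)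
    (hz1 : z ≤ 1) :
    ‖frakfW c' D j 7 (bigP D ^ z) - ffP j 7 z‖ ≤
        (75 * |c'| * π ^ 2 + 40 * |c'| ^ 2 * π ^ 3) * (ell D ^ 8)⁻¹ ∧
      ‖frakgW c' D j 7 (bigP D ^ z) - ghP j 7 z‖ ≤
        (75 * |c'| * π ^ 2 + 40 * |c'| ^ 2 * π ^ 3) * (ell D ^ 8)⁻¹ := by
  obtain ⟨hf, hg⟩ := constants_le c' hD
  obtain ⟨f1, f2, f3⟩ := frakfW_seven c' hD hz0 hz1
  obtain ⟨g1, g2, g3⟩ := frakgW_seven c' hD hz0 hz1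
  simp only [Finset.mem_insert, Finset.mem_singleton] at hj
  rcases hj with rfl | rfl | rfl
  · rw [ffP_one_seven, ghP_one_seven]; exact ⟨f1.trans hf, g1.trans hg⟩
  · rw [ffP_two_seven, ghP_two_seven]; exact ⟨f2.trans hf, g2.trans hg⟩
  · rw [ffP_three_seven, ghP_three_seven]; exact ⟨f3.trans hf, g3.trans hg⟩

/-- **`Z22:§8.u049` DISCHARGED** (p. 48 last line, tex L2480): the typed claim
`Section8dStatements.Step8u049 c′` — "for `0 ≤ z ≤ 1`, `𝔣_{j6}(Pᶻ) = 𝔣𝔣_{j6}(z) + O(𝓛⁻⁸)`,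
`𝔤_{j6}(Pᶻ) = 𝔤𝔥_{j6}(z) + O(𝓛⁻⁸)`" for the true shifts, `j ∈ {1,2,3}` — HOLDS, with
`C = 75|c′|π² + 40c′²π³` and every `D ≥ 3`. [cite: Zhang2022LandauSiegel, §8 p.48, tex L2480] -/
theorem step8u049_holds : Step8u049 c' :=
  ⟨75 * |c'| * π ^ 2 + 40 * |c'| ^ 2 * π ^ 3, 3,
    fun _ _ _ hD _ _ _ hj _ hz0 hz1 => profiles_six c' hD hj hz0 hz1⟩

/-- `Step8u049` — `_holds` alias of `step8u049_holds` above under the fact's exact name (appended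
2026-08-28, D-0026 bookkeeping: the proof term is the existing theorem of this file; no statement,
definition or attribute is edited; no new named fact; the ledger's debt table listed the fact
unproved). [cite: Zhang2022LandauSiegel, §8 p.48, tex L2480] -/
theorem _root_.Literature.NumberTheory.LFunctions.Zhang2022.Section8dStatements.Step8u049_holds :
    Step8u049 c' :=
  _root_.Literature.NumberTheory.LFunctions.Zhang2022.Section8ProfilesAtPz.step8u049_holds (c' := c')

/-- **`Z22:§8.u050` DISCHARGED** (p. 49 first line, tex L2483): the typed claim
`Section8dStatements.Step8u050 c′` (`μ = 7`) HOLDS, same constant and threshold.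
[cite: Zhang2022LandauSiegel, §8 p.49, tex L2483] -/
theorem step8u050_holds : Step8u050 c' :=
  ⟨75 * |c'| * π ^ 2 + 40 * |c'| ^ 2 * π ^ 3, 3,
    fun _ _ _ hD _ _ _ hj _ hz0 hz1 => profiles_seven c' hD hj hz0 hz1⟩

/-- `Step8u050` — `_holds` alias of `step8u050_holds` above under the fact's exact name (appended
2026-08-28, D-0026 bookkeeping: the proof term is the existing theorem of this file; no statement,
definition or attribute is edited; no new named fact; the ledger's debt table listed the fact
unproved). [cite: Zhang2022LandauSiegel, §8 p.49, tex L2483] -/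
theorem _root_.Literature.NumberTheory.LFunctions.Zhang2022.Section8dStatements.Step8u050_holds :
    Step8u050 c' :=
  _root_.Literature.NumberTheory.LFunctions.Zhang2022.Section8ProfilesAtPz.step8u050_holds (c' := c')

end Typed

end Literature.NumberTheory.LFunctions.Zhang2022.Section8ProfilesAtPz
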